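import Summits.HubbardSuperconductivity.HubbardSuperconductivity.Theorems.AnisotropyChordInsertionEntropyJelliumSheet
import Summits.HubbardSuperconductivity.HubbardSuperconductivity.Theorems.AnisotropyChordInsertionEntropyUniformDensity

/-!
# Route `AnisotropyChord` / H0 rotor rung: the CANONICAL (fixed particle number) Jastrow state — two-defect screening
# ⇒ OFF-DIAGONAL LONG-RANGE ORDER of the wavefunction itself, Hamiltonian-free
# (composition of theory seat `hubbard-h0-rotor-theory-1` memo ROTOR-THEORY-9 §130 (one-state E-floor) with §135 (J2);
# closes the ensemble gap between the grand-canonical R8 and the sector hypotheses of the one-state floor)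

The one-state E-floor `condensateDensity_ge_of_teleEntropy'` needs an `N`-sector amplitude; the Jastrow amplitude
`jastrowAmp w` of `…InsertionEntropyJastrow` lives on all configurations.  Here:
* `particleCount σ = #{z : σ z = 0}`, `jastrowSectorWeight w N = Z_N = Σ_{|σ|=N} ψ_w(σ)²`, and the CANONICAL Jastrow
  amplitude `jastrowSectorAmp w N = [|σ| = N] ψ_w / √Z_N` (non-negative, unit, `N`-sector supported, invariant under
  `w`-preserving relabellings);
* **J1 for non-negative amplitudes** `klDiv_teleLaw_eq_of_support` (support symmetry replaces positivity) and
  **canonical J2** `klDiv_teleLaw_jastrowSector` : the teleportation KL of the canonical state is again the mean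
  spectator-potential shift `E[Φ_τ(y) − Φ_τ(x)]`, now under the CANONICAL two-defect law (the `1/√Z_N` cancels);
* **`condensateDensity_jastrowSector_ge`** : on `(ℤ/L)²` with an even difference kernel `W`, a bound `K` on the canonical
  mean spectator shift for all `x ≠ y` gives `n₀/|Λ| ≥ (N/L²)(1 − N/L²) e^{−K/2}` for the canonical Jastrow state —
  ODLRO of the Rokhsar–Kivelson wavefunction from classical screening, no Hamiltonian, any filling;
* typed **R8c** `JelliumSheetCanonicalScreening β c` (canonical version of R8's screening statement; OPEN) and
  **`condensateDensity_jelliumSheet_ge`** : R8c ⇒ a uniform condensate-density floor `ρ_L(1−ρ_L)e^{−C/2}` for the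
  canonical jellium-sheet states at every `L` and `N`.
-/

set_option linter.dupNamespace false

noncomputable section

open Finset
open Literature.Probability.LatticeModels

namespace Summit.HubbardSuperconductivity.HubbardSuperconductivity.Theorems.AnisotropyChord.InsertionEntropy

section JastrowCanonical

variable {V : Type} [Fintype V] [DecidableEq V]

/-- Particle number `#{z : σ z = 0}` of a hard-core configuration. [folklore] -/
def particleCount (σ : V → Fin 2) : ℕ := (univ.filter fun z => σ z = 0).card

/-- Canonical partition weight `Z_N = Σ_{|σ| = N} ψ_w(σ)²`. [folklore] -/
def jastrowSectorWeight (w : V → V → ℝ) (N : ℕ) : ℝ :=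
  ∑ σ : V → Fin 2, if particleCount σ = N then jastrowAmp w σ ^ 2 else 0

/-- The CANONICAL Jastrow amplitude `ψ_{w,N}(σ) = [|σ| = N] ψ_w(σ)/√Z_N` (the `N`-particle Rokhsar–Kivelson state). [folklore] -/
def jastrowSectorAmp (w : V → V → ℝ) (N : ℕ) (σ : V → Fin 2) : ℝ :=
  if particleCount σ = N then jastrowAmp w σ / Real.sqrt (jastrowSectorWeight w N) else 0

/-- `Z_N ≥ 0`. [folklore] -/
theorem jastrowSectorWeight_nonneg (w : V → V → ℝ) (N : ℕ) : 0 ≤ jastrowSectorWeight w N :=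
  Finset.sum_nonneg fun σ _ => by split_ifs <;> [exact sq_nonneg _; exact le_rfl]

/-- `Z_N > 0` as soon as the sector is non-empty. [folklore] -/
theorem jastrowSectorWeight_pos (w : V → V → ℝ) (N : ℕ) (h : ∃ σ : V → Fin 2, particleCount σ = N) :
    0 < jastrowSectorWeight w N := by
  obtain ⟨σ, hσ⟩ := h
  unfold jastrowSectorWeight
  have hle : (if particleCount σ = N then jastrowAmp w σ ^ 2 else 0)
      ≤ ∑ σ' : V → Fin 2, (if particleCount σ' = N then jastrowAmp w σ' ^ 2 else 0) :=
    Finset.single_le_sum (f := fun σ' : V → Fin 2 => (if particleCount σ' = N then jastrowAmp w σ' ^ 2 else 0))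
      (fun σ' _ => by
        show (0 : ℝ) ≤ (if particleCount σ' = N then jastrowAmp w σ' ^ 2 else 0)
        split_ifs
        · exact sq_nonneg _
        · exact le_rfl) (Finset.mem_univ σ)
  rw [if_pos hσ] at hle
  exact lt_of_lt_of_le (pow_pos (jastrowAmp_pos w σ) 2) hle

/-- The canonical amplitude is non-negative. [folklore] -/
theorem jastrowSectorAmp_nonneg (w : V → V → ℝ) (N : ℕ) (σ : V → Fin 2) : 0 ≤ jastrowSectorAmp w N σ := by
  unfold jastrowSectorAmp
  split_ifs
  · exact div_nonneg (jastrowAmp_pos w σ).le (Real.sqrt_nonneg _)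
  · exact le_rfl

/-- The canonical amplitude is supported on the `N`-sector. [folklore] -/
theorem particleCount_eq_of_jastrowSectorAmp_ne_zero (w : V → V → ℝ) (N : ℕ) (σ : V → Fin 2)
    (h : jastrowSectorAmp w N σ ≠ 0) : particleCount σ = N := by
  by_contra hne
  unfold jastrowSectorAmp at h
  rw [if_neg hne] at h
  exact h rfl

/-- On the sector the canonical amplitude is positive (`Z_N > 0`). [folklore] -/
theorem jastrowSectorAmp_pos (w : V → V → ℝ) (N : ℕ) (hZ : 0 < jastrowSectorWeight w N) (σ : V → Fin 2)
    (hσ : particleCount σ = N) : 0 < jastrowSectorAmp w N σ := by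
  unfold jastrowSectorAmp
  rw [if_pos hσ]
  exact div_pos (jastrowAmp_pos w σ) (Real.sqrt_pos.mpr hZ)

/-- The canonical amplitude is a unit vector (`Z_N > 0`). [folklore] -/
theorem sum_jastrowSectorAmp_sq (w : V → V → ℝ) (N : ℕ) (hZ : 0 < jastrowSectorWeight w N) :
    ∑ σ, jastrowSectorAmp w N σ ^ 2 = 1 := by
  have hs : 0 < Real.sqrt (jastrowSectorWeight w N) := Real.sqrt_pos.mpr hZ
  have h1 : ∀ σ : V → Fin 2, jastrowSectorAmp w N σ ^ 2
      = (if particleCount σ = N then jastrowAmp w σ ^ 2 else 0) / jastrowSectorWeight w N := by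
    intro σ
    unfold jastrowSectorAmp
    split_ifs
    · rw [div_pow, Real.sq_sqrt hZ.le]
    · simp
  rw [Finset.sum_congr rfl fun σ _ => h1 σ, ← Finset.sum_div]
  exact div_self hZ.ne'

omit [DecidableEq V] in
/-- Particle number is invariant under relabelling. [folklore] -/
theorem particleCount_comp_equiv (r : V ≃ V) (σ : V → Fin 2) : particleCount (σ ∘ r) = particleCount σ := by
  unfold particleCount
  refine Finset.card_bij (fun z _ => r z) (fun z hz => ?_) (fun z₁ _ z₂ _ h => r.injective h) (fun z hz => ?_)
  · simp only [Finset.mem_filter, Finset.mem_univ, true_and, Function.comp_apply] at hz ⊢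
    exact hz
  · refine ⟨r.symm z, ?_, r.apply_symm_apply z⟩
    simp only [Finset.mem_filter, Finset.mem_univ, true_and, Function.comp_apply] at hz ⊢
    rw [r.apply_symm_apply]
    exact hz

/-- The canonical Jastrow amplitude is invariant under `w`-preserving relabellings. [folklore] -/
theorem jastrowSectorAmp_comp_equiv (w : V → V → ℝ) (N : ℕ) (r : V ≃ V) (hr : ∀ u v, w (r u) (r v) = w u v)
    (σ : V → Fin 2) : jastrowSectorAmp w N (σ ∘ r) = jastrowSectorAmp w N σ := by
  unfold jastrowSectorAmp
  rw [particleCount_comp_equiv, jastrowAmp_comp_equiv w r hr σ]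

/-- Removing the hole at `x` (`τ x = 1`) adds one particle. [folklore] -/
theorem filter_update_eq_insert (τ : V → Fin 2) (x : V) (hx : τ x = 1) :
    (univ.filter fun z => Function.update τ x 0 z = 0) = insert x (univ.filter fun z => τ z = 0) := by
  ext z
  simp only [Finset.mem_filter, Finset.mem_univ, true_and, Finset.mem_insert]
  by_cases hz : z = x
  · subst hz; simp
  · rw [Function.update_of_ne hz]
    constructor
    · intro h; exact Or.inr h
    · rintro (h | h)
      · exact absurd h hz
      · exact h

/-- `|τ + x| = |τ| + 1` when `x` is empty in `τ`. [folklore] -/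
theorem particleCount_update (τ : V → Fin 2) (x : V) (hx : τ x = 1) :
    particleCount (Function.update τ x 0) = particleCount τ + 1 := by
  unfold particleCount
  rw [filter_update_eq_insert τ x hx, Finset.card_insert_of_notMem]
  simp [hx]

/-- A positive contribution makes the pair mass positive. [folklore] -/
theorem pairMass_pos_of_mem (a : (V → Fin 2) → ℝ) (x y : V) (τ : V → Fin 2) (h : τ x = 1 ∧ τ y = 1)
    (hpos : 0 < a (Function.update τ x 0)) : 0 < pairMass a x y := by
  unfold pairMass
  have hle : (if τ x = 1 ∧ τ y = 1 then a (Function.update τ x 0) ^ 2 else 0)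
      ≤ ∑ τ' : V → Fin 2, (if τ' x = 1 ∧ τ' y = 1 then a (Function.update τ' x 0) ^ 2 else 0) :=
    Finset.single_le_sum (f := fun τ' : V → Fin 2 =>
        (if τ' x = 1 ∧ τ' y = 1 then a (Function.update τ' x 0) ^ 2 else 0))
      (fun τ' _ => by
        show (0 : ℝ) ≤ (if τ' x = 1 ∧ τ' y = 1 then a (Function.update τ' x 0) ^ 2 else 0)
        split_ifs
        · exact sq_nonneg _
        · exact le_rfl) (Finset.mem_univ τ)
  rw [if_pos h] at hle
  exact lt_of_lt_of_le (pow_pos hpos 2) hle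

/-- **J1 for non-negative amplitudes.**  If the insertion supports at `x` and at `y` agree on `{τ x = τ y = 1}` and
`a_{yx} = a_{xy}`, then `KL(ν_x^{(y)} ‖ ν_y^{(x)}) = E_{ν_x^{(y)}} [2 log ψ(τ+x) − 2 log ψ(τ+y)]`. [folklore] -/
theorem klDiv_teleLaw_eq_of_support (a : (V → Fin 2) → ℝ) (hN : ∀ σ, 0 ≤ a σ) (x y : V)
    (hsupp : ∀ τ : V → Fin 2, τ x = 1 → τ y = 1 →
      (0 < a (Function.update τ x 0) ↔ 0 < a (Function.update τ y 0)))
    (hm : pairMass a y x = pairMass a x y) :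
    klDiv (teleLaw a x y) (teleLaw a y x)
      = ∑ τ, teleLaw a x y τ *
          (2 * Real.log (a (Function.update τ x 0)) - 2 * Real.log (a (Function.update τ y 0))) := by
  unfold klDiv
  refine Finset.sum_congr rfl fun τ _ => ?_
  by_cases h : τ x = 1 ∧ τ y = 1
  · have hp : teleLaw a x y τ = a (Function.update τ x 0) ^ 2 / pairMass a x y := by
      unfold teleLaw; rw [if_pos h]
    have hq : teleLaw a y x τ = a (Function.update τ y 0) ^ 2 / pairMass a x y := by
      unfold teleLaw; rw [if_pos ⟨h.2, h.1⟩, hm]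
    rcases eq_or_lt_of_le (hN (Function.update τ x 0)) with h0 | hax
    · rw [hp, ← h0]; simp
    · have hay : 0 < a (Function.update τ y 0) := (hsupp τ h.1 h.2).mp hax
      have hm0 : 0 < pairMass a x y := pairMass_pos_of_mem a x y τ h hax
      rw [hp, hq]
      have hratio : a (Function.update τ x 0) ^ 2 / pairMass a x y / (a (Function.update τ y 0) ^ 2 / pairMass a x y)
          = a (Function.update τ x 0) ^ 2 / a (Function.update τ y 0) ^ 2 := by
        field_simp
      rw [hratio, Real.log_div (ne_of_gt (pow_pos hax 2)) (ne_of_gt (pow_pos hay 2)), Real.log_pow, Real.log_pow]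
      push_cast
      ring
  · have hp : teleLaw a x y τ = 0 := by unfold teleLaw; rw [if_neg h]
    rw [hp, zero_mul, zero_mul]

/-- **Canonical J2 — the teleportation entropy of the `N`-particle Jastrow state is the CANONICAL mean spectator-potential
shift:** `KL(ν_x^{(y)} ‖ ν_y^{(x)}) = E_{ν_x^{(y)}} [Φ_τ(y) − Φ_τ(x)]`, the expectation now under the law of the `N − 1`
spectators of the canonical gas given «particle at `x`, vacancy at `y`» (the normalisation `1/√Z_N` cancels). [folklore] -/
theorem klDiv_teleLaw_jastrowSector (w : V → V → ℝ) (hw : ∀ u v, w u v = w v u) (N : ℕ)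
    (hZ : 0 < jastrowSectorWeight w N) (x y : V) (hμ : w x x = w y y)
    (hm : pairMass (jastrowSectorAmp w N) y x = pairMass (jastrowSectorAmp w N) x y) :
    klDiv (teleLaw (jastrowSectorAmp w N) x y) (teleLaw (jastrowSectorAmp w N) y x)
      = ∑ τ, teleLaw (jastrowSectorAmp w N) x y τ * (spectatorField w τ y - spectatorField w τ x) := by
  have hsupp : ∀ τ : V → Fin 2, τ x = 1 → τ y = 1 →
      (0 < jastrowSectorAmp w N (Function.update τ x 0) ↔ 0 < jastrowSectorAmp w N (Function.update τ y 0)) := by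
    intro τ hx hy
    have hcx := particleCount_update τ x hx
    have hcy := particleCount_update τ y hy
    constructor
    · intro h
      have hc := particleCount_eq_of_jastrowSectorAmp_ne_zero w N _ h.ne'
      exact jastrowSectorAmp_pos w N hZ _ (by rw [hcy, ← hcx, hc])
    · intro h
      have hc := particleCount_eq_of_jastrowSectorAmp_ne_zero w N _ h.ne'
      exact jastrowSectorAmp_pos w N hZ _ (by rw [hcx, ← hcy, hc])
  rw [klDiv_teleLaw_eq_of_support (jastrowSectorAmp w N) (jastrowSectorAmp_nonneg w N) x y hsupp hm]
  refine Finset.sum_congr rfl fun τ _ => ?_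
  by_cases h : τ x = 1 ∧ τ y = 1
  · by_cases hc : particleCount (Function.update τ x 0) = N
    · have hc' : particleCount (Function.update τ y 0) = N := by
        rw [particleCount_update τ y h.2, ← particleCount_update τ x h.1, hc]
      have hs : 0 < Real.sqrt (jastrowSectorWeight w N) := Real.sqrt_pos.mpr hZ
      have ex : jastrowSectorAmp w N (Function.update τ x 0)
          = jastrowAmp w (Function.update τ x 0) / Real.sqrt (jastrowSectorWeight w N) := by
        unfold jastrowSectorAmp; rw [if_pos hc]
      have ey : jastrowSectorAmp w N (Function.update τ y 0)
          = jastrowAmp w (Function.update τ y 0) / Real.sqrt (jastrowSectorWeight w N) := by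
        unfold jastrowSectorAmp; rw [if_pos hc']
      rw [ex, ey, Real.log_div (jastrowAmp_pos w _).ne' hs.ne', Real.log_div (jastrowAmp_pos w _).ne' hs.ne']
      have key : 2 * Real.log (jastrowAmp w (Function.update τ x 0)) - 2 * Real.log (jastrowAmp w (Function.update τ y 0))
          = spectatorField w τ y - spectatorField w τ x := by
        rw [two_mul_log_jastrowAmp, two_mul_log_jastrowAmp, jastrowLogWeight_update w hw τ x h.1,
          jastrowLogWeight_update w hw τ y h.2, hμ]
        ring
      rw [← key]
      ring
    · have h0 : jastrowSectorAmp w N (Function.update τ x 0) = 0 := by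
        unfold jastrowSectorAmp; rw [if_neg hc]
      have hp : teleLaw (jastrowSectorAmp w N) x y τ = 0 := by
        unfold teleLaw; rw [if_pos h, h0]; simp
      rw [hp, zero_mul, zero_mul]
  · have hp : teleLaw (jastrowSectorAmp w N) x y τ = 0 := by unfold teleLaw; rw [if_neg h]
    rw [hp, zero_mul, zero_mul]

/-- Mutual absolute continuity of the two canonical teleportation laws. [folklore] -/
theorem teleLaw_jastrowSector_pos_symm (w : V → V → ℝ) (N : ℕ) (hZ : 0 < jastrowSectorWeight w N) (x y : V)
    (τ : V → Fin 2) (h : 0 < teleLaw (jastrowSectorAmp w N) x y τ) :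
    0 < teleLaw (jastrowSectorAmp w N) y x τ := by
  unfold teleLaw at h ⊢
  by_cases hxy : τ x = 1 ∧ τ y = 1
  · rw [if_pos hxy] at h
    rw [if_pos ⟨hxy.2, hxy.1⟩]
    have hax : 0 < jastrowSectorAmp w N (Function.update τ x 0) := by
      rcases eq_or_lt_of_le (jastrowSectorAmp_nonneg w N (Function.update τ x 0)) with h0 | h0
      · rw [← h0] at h; simp at h
      · exact h0
    have hc := particleCount_eq_of_jastrowSectorAmp_ne_zero w N _ hax.ne'
    have hay : 0 < jastrowSectorAmp w N (Function.update τ y 0) :=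
      jastrowSectorAmp_pos w N hZ _ (by rw [particleCount_update τ y hxy.2, ← particleCount_update τ x hxy.1, hc])
    exact div_pos (pow_pos hay 2) (pairMass_pos_of_mem _ y x τ ⟨hxy.2, hxy.1⟩ hay)
  · rw [if_neg hxy] at h
    exact absurd h (lt_irrefl 0)

/-- **ODLRO OF THE CANONICAL JASTROW STATE FROM TWO-DEFECT SCREENING (PROVED, Hamiltonian-free).**  On `(ℤ/L)²` with an
even difference kernel `W`, if the canonical mean spectator-potential shift between a pinned vacancy and a pinned
particle is `≤ K` for all `x ≠ y`, then the `N`-particle Rokhsar–Kivelson state `ψ_{W,N}` has condensate density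
`n₀/|Λ| ≥ (N/L²)(1 − N/L²)·e^{−K/2}` — translation invariance gives uniform density, canonical J2 turns the screening
bound into the entropy bound, and the one-state E-floor concludes. [folklore] -/
theorem condensateDensity_jastrowSector_ge (L : ℕ) [NeZero L] (W : TorusSite 2 L → ℝ) (hW : ∀ v, W (-v) = W v)
    (N : ℕ) (hZ : 0 < jastrowSectorWeight (fun u v : TorusSite 2 L => W (u - v)) N) (K : ℝ)
    (hK : ∀ x y : TorusSite 2 L, x ≠ y →
      ∑ τ, teleLaw (jastrowSectorAmp (fun u v => W (u - v)) N) x y τ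
          * (spectatorField (fun u v => W (u - v)) τ y - spectatorField (fun u v => W (u - v)) τ x) ≤ K) :
    ((N : ℝ) / (L : ℝ) ^ 2) * (1 - (N : ℝ) / (L : ℝ) ^ 2) * Real.exp (-K / 2)
      ≤ condensateDensity (jastrowSectorAmp (fun u v => W (u - v)) N) := by
  set w : TorusSite 2 L → TorusSite 2 L → ℝ := fun u v => W (u - v) with hwdef
  set a := jastrowSectorAmp w N with hadef
  have hw : ∀ u v, w u v = w v u := fun u v => by
    show W (u - v) = W (v - u)
    rw [← hW (u - v), neg_sub]
  -- translation invariance ⇒ uniform density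
  have hinv : ∀ v : TorusSite 2 L, ∀ σ, a (σ ∘ (Equiv.addRight v)) = a σ := by
    intro v σ
    exact jastrowSectorAmp_comp_equiv w N (Equiv.addRight v) (fun u u' => by
      show W (u + v - (u' + v)) = W (u - u')
      congr 1; abel) σ
  have hdens : ∀ x : TorusSite 2 L, siteDensity a x = siteDensity a 0 := by
    intro x
    have h := siteDensity_comp_equiv (Equiv.addRight x) a (hinv x) 0
    have h0 : (Equiv.addRight x) (0 : TorusSite 2 L) = x := by simp
    rw [h0] at h
    exact h
  have hsym : ∀ x y, pairMass a x y = pairMass a y x :=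
    pairMass_symm_of_siteDensity a (siteDensity a 0) hdens
  have hsect : ∀ σ, a σ ≠ 0 → ((univ.filter fun z => σ z = 0).card : ℝ) = (N : ℝ) := by
    intro σ hσ
    exact_mod_cast particleCount_eq_of_jastrowSectorAmp_ne_zero w N σ hσ
  have hKL : ∀ x y : TorusSite 2 L, x ≠ y → klDiv (teleLaw a x y) (teleLaw a y x) ≤ K := by
    intro x y hxy
    rw [hadef, klDiv_teleLaw_jastrowSector w hw N hZ x y (by simp [hwdef]) (hsym y x)]
    exact hK x y hxy
  have main := condensateDensity_ge_of_teleEntropy' a (N : ℝ) (siteDensity a 0) K (jastrowSectorAmp_nonneg w N)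
    (sum_jastrowSectorAmp_sq w N hZ) hsect hdens
    (fun x y τ _ h => teleLaw_jastrowSector_pos_symm w N hZ x y τ h) hKL
  have hcard : (Fintype.card (TorusSite 2 L) : ℝ) = (L : ℝ) ^ 2 := by
    rw [Fintype.card_fun, ZMod.card, Fintype.card_fin]; push_cast; ring
  rw [hcard] at main
  exact main

/-- **CONJECTURE R8c — `JelliumSheetCanonicalScreening` (canonical two-defect screening of the jellium sheet; OPEN).**
For the CANONICAL jellium-sheet gas (`N` particles on `(ℤ/L)²`, pair potential `β/d`, any diagonal constant `c`), the
mean spectator-potential difference between a pinned vacancy and a pinned particle is bounded uniformly in `L`, `N` and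
the pins.  The fixed-`N` counterpart of R8/R8a/R8b of `…JelliumSheet` / `…JelliumScreening` (there the state is grand
canonical); expected from Debye–Hückel screening in the density window.
[conjecture: theory seat hubbard-h0-rotor-theory-1, cycle 9, 2026-08-28 — memo ROTOR-THEORY-9 §135, canonical form (OPEN)] -/
def JelliumSheetCanonicalScreening (β c : ℝ) : Prop :=
  ∃ C : ℝ, ∀ L : ℕ, ∀ [NeZero L], ∀ N : ℕ, 0 < jastrowSectorWeight (sheetKernel L β c) N →
    ∀ x y : TorusSite 2 L, x ≠ y →
      ∑ τ, teleLaw (jastrowSectorAmp (sheetKernel L β c) N) x y τ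
          * (spectatorField (sheetKernel L β c) τ y - spectatorField (sheetKernel L β c) τ x) ≤ C

/-- **R8c ⇒ ODLRO of the canonical jellium-sheet Rokhsar–Kivelson states at every filling (PROVED link):**
`n₀/|Λ| ≥ (N/L²)(1 − N/L²) e^{−C/2}` for all `L`, `N` (non-empty sector). [folklore] -/
theorem condensateDensity_jelliumSheet_ge (β c : ℝ) (h : JelliumSheetCanonicalScreening β c) :
    ∃ C : ℝ, ∀ L : ℕ, ∀ [NeZero L], ∀ N : ℕ, 0 < jastrowSectorWeight (sheetKernel L β c) N →
      ((N : ℝ) / (L : ℝ) ^ 2) * (1 - (N : ℝ) / (L : ℝ) ^ 2) * Real.exp (-C / 2)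
        ≤ condensateDensity (jastrowSectorAmp (sheetKernel L β c) N) := by
  obtain ⟨C, hC⟩ := h
  refine ⟨C, fun L _ N hZ => ?_⟩
  have hfun := sheetKernel_eq_fun L β c
  have hZ' : 0 < jastrowSectorWeight (fun u v : TorusSite 2 L => sheetFun L β c (u - v)) N := by
    rw [← hfun]; exact hZ
  have h := condensateDensity_jastrowSector_ge L (sheetFun L β c) (sheetFun_neg L β c) N hZ' C (by
    rw [← hfun]; exact hC L N hZ)
  rw [← hfun] at h
  exact h

end JastrowCanonical

end Summit.HubbardSuperconductivity.HubbardSuperconductivity.Theorems.AnisotropyChord.InsertionEntropy
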